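import Summits.Ventures.CertifiedQuantumChemistry.Rows.SingletSpinFreeRow
import Summits.Ventures.CertifiedQuantumChemistry.Rows.OrbitalRotationInvarianceT
import HarnessLib

/-!
# Ventures/CertifiedQuantumChemistry — Rows/SingletSpinAdaptationLossless.lean: the singlet programme
# is covariant under spin rotations; spin adaptation to ANY finite group of spin rotations is LOSSLESS

HONEST FRAMING (verbatim): certified bounds for a stated model Hamiltonian in a stated basis; not a
claim about the real molecule beyond that model.

Seat rdm-A (gen 60), ROWS file (theorems only; no `def`, no notation; zero compute; nothing landed is
touched); sequel to `Rows/SingletSpinFreeRow.lean` (the printed singlet programme = the spin-orbital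
`N`-programme + the one spin-free row `Y(Γ) = 2n(2−n)`). A SPIN ROTATION acts on the spin orbitals by
the lift `U = 1_Λ ⊗ u` of a `2 × 2` unitary `u` (`U_{pσ,qτ} = δ_{pq} u_{στ}`, hypothesis `hUu`; cf. the
spin-FREE lifts `u ⊗ 1` of rdm-B's `Rows/OrbitalRotation*` set, whose contraction lemmas §1 mirrors with
the roles of site and spin exchanged) and on pairs by `(γ, Γ) ↦ (UγU†, (U⊗U)Γ(U⊗U)†)`.
* §1–§2 `sum_spinLift_row/col/row₂/col₂`, `conj_spinLift_one/two_apply` — entries of the rotated pair.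
* §3 **`sum_conj_spinLift_one`**, **`sum_sum_conj_spinLift_two`** — for unitary `u` the SPIN-SUMMED
  blocks `Σ_σ γ_{pσ,qσ}` and `Σ_{στ} Γ_{(pσ,rτ),(qσ,sτ)}` (all sites `p r q s`) are INVARIANT; hence
  **`rdmEnergy_conj_spinLift`** (the spin-free energy functional `E_{h,g}` is invariant — the integral
  tables carry no spin) and **`exchangeSum_conj_spinLift`** (the row functional `Y` is invariant).
* §4 `spinLift_mul_conjTranspose` (`uu† = 1 ⇒ UU† = 1`); **`isDQGFeasibleSinglet_sum_smul`** (the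
  singlet-feasible set is convex: the typer's sector convexity + linearity of row (98)).
* §5 **`isDQGFeasibleSinglet_conj_spinLift`** — THE SINGLET-FEASIBLE SET IS INVARIANT UNDER EVERY
  UNITARY SPIN ROTATION: by `isDQGFeasibleSinglet_iff_spinFreeRow` it is `IsDQGFeasible (n+n)`
  (invariant under every unitary of the spin orbitals — rdm-B's `isDQGFeasible_conj_unitary`) cut by the
  invariant row `Y = 2n(2−n)` (in the `S_z`-sector presentation this is invisible: a spin rotation
  breaks the selection rule of `γ` entrywise; the rotated pair nevertheless satisfies every printed
  singlet row again); `isDQGT1T2PrimeFeasibleSinglet_conj_spinLift` — the same at the `PQGT1T2′` rung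
  (rdm-B's `isDQGT1T2PrimeFeasible_conj_unitary`). **`isDQGFeasibleSinglet_spinRotationAverage`** (the
  average over a finite group `G` of spin rotations `ρ(g) = 1 ⊗ υ(g)` of a singlet-feasible pair is
  singlet-feasible); **`le_pqgSingletEnergy_iff_spinRotationInvariant`** — GATERMANN–PARRILO THM 3.3
  for the singlet programme: `c ≤ E_PQG(2n, S = 0)` iff `c ≤ Re E_{h,g}` on the `ρ`-INVARIANT
  singlet-feasible pairs only (`n ≤ |Λ|`) — spin adaptation LOSES NOTHING, no hypothesis on the tables.
Remark (words, not used): for a finite `G ⊂ SU(2)` whose rotation image acts irreducibly on `ℝ³` (the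
binary tetrahedral group of order 24 is the smallest) the `ρ`-invariant pairs are exactly the fully
spin-adapted ones (`γ = γ^{sf} ⊗ 1`; `Γ` = singlet ⊕ triplet blocks, Mazziotti 2007 §II.F (87)–(95)), by
Schur's lemma on `½` and on `½ ⊗ ½ = 0 ⊕ 1`; for `G = {1, spin flip}` they are the `α ↔ β`-symmetric pairs.
Everything is PROVED (0 sorry, standard axioms); no definitions, no named facts; nothing asserts a bound
about any model; no claim node, no hint / row depends on it. NOT here: the LOSSLESS statement at the
`T1`/`T2′` rung (its covariance is here), the explicit singlet/triplet block structure.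
References: D. A. Mazziotti, in *Reduced-Density-Matrix Mechanics*, Adv. Chem. Phys. 134 (Wiley 2007)
ch. 3 §II.F–G eqs. (87)–(98) (held copy PDF pp. 48–50); G. Gidofalvi, D. A. Mazziotti, Phys. Rev. A 72
(2005) 052505 (spin and symmetry adaptation of the variational 2-RDM method); K. Gatermann,
P. A. Parrilo, J. Pure Appl. Algebra 192 (2004) 95–128, Thm 3.3.
Tree (REUSED): `isDQGFeasibleSinglet_iff_spinFreeRow`, `isDQGT1T2PrimeFeasibleSinglet_iff_spinFreeRow`
(rdm-A `Rows/SingletSpinFreeRow`); `isDQGFeasible_conj_unitary`, `isDQGT1T2PrimeFeasible_conj_unitary`,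
`rotationAverage_one_conj`, `rotationAverage_two_conj`, `rdmEnergy_rotationAverage` (rdm-B
`Rows/OrbitalRotationCovariance(T)` / `Rows/OrbitalRotationAveraging`, imported through
`Rows/OrbitalRotationInvarianceT`); `IsDQGFeasibleSector.sum_smul`, `le_pqgSingletEnergy_iff`,
`rdmEnergy`, `sum_orb_eq_sum_sum` (typer / QuantumLattice). Mathlib: `Matrix.mul_eq_one_comm`.
-/

noncomputable section

namespace Summit.Ventures.CertifiedQuantumChemistry

open Matrix Finset
open Literature.MathematicalPhysics.QuantumLattice Literature.MathematicalPhysics.QuantumChemistry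
open scoped ComplexOrder Kronecker

variable {Λ : Type*} [LinearOrder Λ] [Fintype Λ]
variable {U : Matrix (Orb Λ) (Orb Λ) ℂ} {u : Matrix (Fin 2) (Fin 2) ℂ}

/-! ## §1 Contractions against a spin lift `U = 1 ⊗ u` -/

/-- Row contraction against a spin lift: `Σ_y U_{pσ,y} f(y) = Σ_a u_{σa} f(pa)`. -/
theorem sum_spinLift_row (hUu : ∀ p q σ τ, U (orb p σ) (orb q τ) = if p = q then u σ τ else 0)
    (f : Orb Λ → ℂ) (p : Λ) (σ : Fin 2) : ∑ y, U (orb p σ) y * f y = ∑ a, u σ a * f (orb p a) := by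
  rw [sum_orb_eq_sum_sum, Finset.sum_eq_single p]
  · exact Finset.sum_congr rfl fun a _ => by rw [hUu, if_pos rfl]
  · intro q _ hne
    exact Finset.sum_eq_zero fun a _ => by rw [hUu, if_neg (Ne.symm hne), zero_mul]
  · exact fun h => (h (Finset.mem_univ p)).elim

/-- Column contraction against a spin lift: `Σ_x f(x) conj(U_{qτ,x}) = Σ_b f(qb) conj(u_{τb})`. -/
theorem sum_spinLift_col (hUu : ∀ p q σ τ, U (orb p σ) (orb q τ) = if p = q then u σ τ else 0)
    (f : Orb Λ → ℂ) (q : Λ) (τ : Fin 2) :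
    ∑ x, f x * star (U (orb q τ) x) = ∑ b, f (orb q b) * star (u τ b) := by
  rw [sum_orb_eq_sum_sum, Finset.sum_eq_single q]
  · exact Finset.sum_congr rfl fun b _ => by rw [hUu, if_pos rfl]
  · intro q' _ hne
    exact Finset.sum_eq_zero fun b _ => by rw [hUu, if_neg (Ne.symm hne), star_zero, mul_zero]
  · exact fun h => (h (Finset.mem_univ q)).elim

/-- Pair-row contraction against `U ⊗ U` for a spin lift. -/
theorem sum_spinLift_row₂ (hUu : ∀ p q σ τ, U (orb p σ) (orb q τ) = if p = q then u σ τ else 0)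
    (f : Orb Λ × Orb Λ → ℂ) (p r : Λ) (σ τ : Fin 2) :
    ∑ Y, (U ⊗ₖ U) (orb p σ, orb r τ) Y * f Y = ∑ a, ∑ c, u σ a * u τ c * f (orb p a, orb r c) := by
  calc ∑ Y, (U ⊗ₖ U) (orb p σ, orb r τ) Y * f Y
      = ∑ y₁, U (orb p σ) y₁ * ∑ y₂, U (orb r τ) y₂ * f (y₁, y₂) := by
        rw [Fintype.sum_prod_type]
        refine Finset.sum_congr rfl fun y₁ _ => ?_
        rw [Finset.mul_sum]
        refine Finset.sum_congr rfl fun y₂ _ => ?_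
        rw [kroneckerMap_apply, mul_assoc]
    _ = ∑ y₁, U (orb p σ) y₁ * ∑ c, u τ c * f (y₁, orb r c) := by
        refine Finset.sum_congr rfl fun y₁ _ => ?_
        rw [sum_spinLift_row hUu (fun y₂ => f (y₁, y₂)) r τ]
    _ = ∑ a, u σ a * ∑ c, u τ c * f (orb p a, orb r c) :=
        sum_spinLift_row hUu (fun y₁ => ∑ c, u τ c * f (y₁, orb r c)) p σ
    _ = ∑ a, ∑ c, u σ a * u τ c * f (orb p a, orb r c) := by
        refine Finset.sum_congr rfl fun a _ => ?_
        rw [Finset.mul_sum]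
        exact Finset.sum_congr rfl fun c _ => by rw [mul_assoc]

/-- Pair-column contraction against `(U ⊗ U)†` for a spin lift. -/
theorem sum_spinLift_col₂ (hUu : ∀ p q σ τ, U (orb p σ) (orb q τ) = if p = q then u σ τ else 0)
    (f : Orb Λ × Orb Λ → ℂ) (q s : Λ) (σ τ : Fin 2) :
    ∑ X, f X * (U ⊗ₖ U)ᴴ X (orb q σ, orb s τ) =
      ∑ b, ∑ d, f (orb q b, orb s d) * (star (u σ b) * star (u τ d)) := by
  calc ∑ X, f X * (U ⊗ₖ U)ᴴ X (orb q σ, orb s τ)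
      = ∑ x₁, (∑ x₂, f (x₁, x₂) * star (U (orb s τ) x₂)) * star (U (orb q σ) x₁) := by
        rw [Fintype.sum_prod_type]
        refine Finset.sum_congr rfl fun x₁ _ => ?_
        rw [Finset.sum_mul]
        refine Finset.sum_congr rfl fun x₂ _ => ?_
        rw [conjTranspose_apply, kroneckerMap_apply, star_mul', mul_assoc,
          mul_comm (star (U (orb q σ) x₁))]
    _ = ∑ x₁, (∑ d, f (x₁, orb s d) * star (u τ d)) * star (U (orb q σ) x₁) := by
        refine Finset.sum_congr rfl fun x₁ _ => ?_
        rw [sum_spinLift_col hUu (fun x₂ => f (x₁, x₂)) s τ]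
    _ = ∑ b, (∑ d, f (orb q b, orb s d) * star (u τ d)) * star (u σ b) :=
        sum_spinLift_col hUu (fun x₁ => ∑ d, f (x₁, orb s d) * star (u τ d)) q σ
    _ = ∑ b, ∑ d, f (orb q b, orb s d) * (star (u σ b) * star (u τ d)) := by
        refine Finset.sum_congr rfl fun b _ => ?_
        rw [Finset.sum_mul]
        exact Finset.sum_congr rfl fun d _ => by ring

/-! ## §2 Entries of the spin-rotated pair -/

/-- **Entries of the spin-rotated 1-matrix**: `(UγU†)_{pσ,qτ} = Σ_{ab} u_{σa} conj(u_{τb}) γ_{pa,qb}`. -/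
theorem conj_spinLift_one_apply
    (hUu : ∀ p q σ τ, U (orb p σ) (orb q τ) = if p = q then u σ τ else 0)
    (γ : Matrix (Orb Λ) (Orb Λ) ℂ) (p q : Λ) (σ τ : Fin 2) :
    (U * γ * Uᴴ) (orb p σ) (orb q τ) = ∑ a, ∑ b, u σ a * star (u τ b) * γ (orb p a) (orb q b) := by
  calc (U * γ * Uᴴ) (orb p σ) (orb q τ)
      = ∑ x, (U * γ) (orb p σ) x * star (U (orb q τ) x) := by
        simp only [mul_apply, conjTranspose_apply]
    _ = ∑ b, (U * γ) (orb p σ) (orb q b) * star (u τ b) := sum_spinLift_col hUu _ q τ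
    _ = ∑ b, (∑ a, u σ a * γ (orb p a) (orb q b)) * star (u τ b) := by
        refine Finset.sum_congr rfl fun b _ => ?_
        rw [mul_apply, sum_spinLift_row hUu (fun y => γ y (orb q b)) p σ]
    _ = ∑ b, ∑ a, u σ a * star (u τ b) * γ (orb p a) (orb q b) := by
        refine Finset.sum_congr rfl fun b _ => ?_
        rw [Finset.sum_mul]
        exact Finset.sum_congr rfl fun a _ => by ring
    _ = ∑ a, ∑ b, u σ a * star (u τ b) * γ (orb p a) (orb q b) := Finset.sum_comm

/-- **Entries of the spin-rotated 2-matrix**: `((U⊗U)Γ(U⊗U)†)_{(pσ,rτ),(qσ',sτ')} = Σ_{abcd} u_{σa}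
conj(u_{σ'b}) u_{τc} conj(u_{τ'd}) Γ_{(pa,rc),(qb,sd)}`, bundled over `y = ((b, d), (a, c))`. -/
theorem conj_spinLift_two_apply
    (hUu : ∀ p q σ τ, U (orb p σ) (orb q τ) = if p = q then u σ τ else 0)
    (Γ : Matrix (Orb Λ × Orb Λ) (Orb Λ × Orb Λ) ℂ) (p q r s : Λ) (σ τ σ' τ' : Fin 2) :
    (U ⊗ₖ U * Γ * (U ⊗ₖ U)ᴴ) (orb p σ, orb r τ) (orb q σ', orb s τ') =
      ∑ y : (Fin 2 × Fin 2) × (Fin 2 × Fin 2), u σ y.2.1 * star (u σ' y.1.1) *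
        (u τ y.2.2 * star (u τ' y.1.2)) *
        Γ (orb p y.2.1, orb r y.2.2) (orb q y.1.1, orb s y.1.2) := by
  calc (U ⊗ₖ U * Γ * (U ⊗ₖ U)ᴴ) (orb p σ, orb r τ) (orb q σ', orb s τ')
      = ∑ X, (U ⊗ₖ U * Γ) (orb p σ, orb r τ) X * (U ⊗ₖ U)ᴴ X (orb q σ', orb s τ') := by
        rw [mul_apply]
    _ = ∑ b, ∑ d, (U ⊗ₖ U * Γ) (orb p σ, orb r τ) (orb q b, orb s d) *
          (star (u σ' b) * star (u τ' d)) := sum_spinLift_col₂ hUu _ q s σ' τ'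
    _ = ∑ b, ∑ d, (∑ a, ∑ c, u σ a * u τ c * Γ (orb p a, orb r c) (orb q b, orb s d)) *
          (star (u σ' b) * star (u τ' d)) := by
        refine Finset.sum_congr rfl fun b _ => Finset.sum_congr rfl fun d _ => ?_
        rw [mul_apply, sum_spinLift_row₂ hUu (fun Y => Γ Y (orb q b, orb s d)) p r σ τ]
    _ = ∑ b, ∑ d, ∑ a, ∑ c, u σ a * star (u σ' b) * (u τ c * star (u τ' d)) *
          Γ (orb p a, orb r c) (orb q b, orb s d) := by
        refine Finset.sum_congr rfl fun b _ => Finset.sum_congr rfl fun d _ => ?_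
        rw [Finset.sum_mul]
        refine Finset.sum_congr rfl fun a _ => ?_
        rw [Finset.sum_mul]
        exact Finset.sum_congr rfl fun c _ => by ring
    _ = _ := by simp only [Fintype.sum_prod_type]

/-! ## §3 Spin sums are invariant under a unitary spin rotation -/

/-- Unitarity of `u` in coordinates: `Σ_σ u_{σa} conj(u_{σb}) = δ_{ab}` (`u†u = 1`). -/
theorem sum_mul_star_of_conjTranspose_mul {u : Matrix (Fin 2) (Fin 2) ℂ} (hu' : uᴴ * u = 1)
    (a b : Fin 2) : ∑ σ, u σ a * star (u σ b) = if a = b then 1 else 0 := by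
  have h := congrFun (congrFun hu' b) a
  rw [mul_apply, one_apply] at h
  simp only [conjTranspose_apply] at h
  rw [show (∑ σ, u σ a * star (u σ b)) = ∑ σ, star (u σ b) * u σ a from
    Finset.sum_congr rfl fun σ _ => mul_comm _ _, h]
  by_cases hab : a = b
  · rw [if_pos hab, if_pos hab.symm]
  · rw [if_neg hab, if_neg (Ne.symm hab)]

/-- Kronecker collapse: `Σ_a Σ_b δ_{ab} F(a, b) = Σ_a F(a, a)`. -/
theorem sum_sum_ite_eq_one_mul {ι : Type*} [Fintype ι] [DecidableEq ι] (F : ι → ι → ℂ) :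
    ∑ a, ∑ b, (if a = b then (1 : ℂ) else 0) * F a b = ∑ a, F a a := by
  refine Finset.sum_congr rfl fun a _ => ?_
  simp only [ite_mul, one_mul, zero_mul, Finset.sum_ite_eq, Finset.mem_univ, if_true]

/-- Two Kronecker deltas on the components are one Kronecker delta on the pair. -/
theorem ite_mul_ite_mul_eq {ι κ : Type*} [DecidableEq ι] [DecidableEq κ] (x z : ι × κ) (c : ℂ) :
    (if z.1 = x.1 then (1 : ℂ) else 0) * (if z.2 = x.2 then 1 else 0) * c =
      if z = x then c else 0 := by
  obtain ⟨z₁, z₂⟩ := z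
  obtain ⟨x₁, x₂⟩ := x
  by_cases h₁ : z₁ = x₁ <;> by_cases h₂ : z₂ = x₂ <;> simp [h₁, h₂]

/-- **The spin-summed 1-matrix is invariant under a unitary spin rotation**:
`Σ_σ (UγU†)_{pσ,qσ} = Σ_σ γ_{pσ,qσ}`. -/
theorem sum_conj_spinLift_one
    (hUu : ∀ p q σ τ, U (orb p σ) (orb q τ) = if p = q then u σ τ else 0) (hu' : uᴴ * u = 1)
    (γ : Matrix (Orb Λ) (Orb Λ) ℂ) (p q : Λ) :
    ∑ σ, (U * γ * Uᴴ) (orb p σ) (orb q σ) = ∑ σ, γ (orb p σ) (orb q σ) := by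
  simp only [conj_spinLift_one_apply hUu]
  calc ∑ σ, ∑ a, ∑ b, u σ a * star (u σ b) * γ (orb p a) (orb q b)
      = ∑ a, ∑ b, (∑ σ, u σ a * star (u σ b)) * γ (orb p a) (orb q b) := by
        rw [Finset.sum_comm]
        refine Finset.sum_congr rfl fun a _ => ?_
        rw [Finset.sum_comm]
        exact Finset.sum_congr rfl fun b _ => by rw [Finset.sum_mul]
    _ = ∑ a, γ (orb p a) (orb q a) := by
        simp only [sum_mul_star_of_conjTranspose_mul hu', sum_sum_ite_eq_one_mul]

/-- **The spin-summed 2-matrix blocks are invariant under a unitary spin rotation**: for all sites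
`p r q s` (energy pattern `(p,r;q,s)`, exchange pattern `(p,q;q,p)`), `Σ_{στ} ((U⊗U)Γ(U⊗U)†) = Σ_{στ} Γ`. -/
theorem sum_sum_conj_spinLift_two
    (hUu : ∀ p q σ τ, U (orb p σ) (orb q τ) = if p = q then u σ τ else 0) (hu' : uᴴ * u = 1)
    (Γ : Matrix (Orb Λ × Orb Λ) (Orb Λ × Orb Λ) ℂ) (p r q s : Λ) :
    ∑ σ, ∑ τ, (U ⊗ₖ U * Γ * (U ⊗ₖ U)ᴴ) (orb p σ, orb r τ) (orb q σ, orb s τ) =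
      ∑ σ, ∑ τ, Γ (orb p σ, orb r τ) (orb q σ, orb s τ) := by
  simp only [conj_spinLift_two_apply hUu]
  calc ∑ σ, ∑ τ, ∑ y : (Fin 2 × Fin 2) × (Fin 2 × Fin 2), u σ y.2.1 * star (u σ y.1.1) *
          (u τ y.2.2 * star (u τ y.1.2)) * Γ (orb p y.2.1, orb r y.2.2) (orb q y.1.1, orb s y.1.2)
      = ∑ y : (Fin 2 × Fin 2) × (Fin 2 × Fin 2), (∑ σ, u σ y.2.1 * star (u σ y.1.1)) *
          (∑ τ, u τ y.2.2 * star (u τ y.1.2)) *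
          Γ (orb p y.2.1, orb r y.2.2) (orb q y.1.1, orb s y.1.2) := by
        rw [Finset.sum_congr rfl fun σ _ => Finset.sum_comm, Finset.sum_comm]
        refine Finset.sum_congr rfl fun y _ => ?_
        rw [Finset.sum_mul_sum, Finset.sum_mul]
        refine Finset.sum_congr rfl fun σ _ => ?_
        rw [Finset.sum_mul]
    _ = ∑ x : Fin 2 × Fin 2, Γ (orb p x.1, orb r x.2) (orb q x.1, orb s x.2) := by
        simp only [sum_mul_star_of_conjTranspose_mul hu']
        rw [Fintype.sum_prod_type]
        refine Finset.sum_congr rfl fun x _ => ?_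
        simp only [ite_mul_ite_mul_eq, Finset.sum_ite_eq', Finset.mem_univ, if_true]
    _ = ∑ σ, ∑ τ, Γ (orb p σ, orb r τ) (orb q σ, orb s τ) := Fintype.sum_prod_type _

/-- **The energy functional is invariant under a unitary spin rotation** (the integral tables are
spin-free): `E_{h,g}(UγU†, (U⊗U)Γ(U⊗U)†) = E_{h,g}(γ, Γ)` for `U = 1 ⊗ u`, `u†u = 1`. -/
theorem rdmEnergy_conj_spinLift
    (hUu : ∀ p q σ τ, U (orb p σ) (orb q τ) = if p = q then u σ τ else 0) (hu' : uᴴ * u = 1)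
    (h : Λ → Λ → ℂ) (g : Λ → Λ → Λ → Λ → ℂ) (hnuc : ℂ) (γ : Matrix (Orb Λ) (Orb Λ) ℂ)
    (Γ : Matrix (Orb Λ × Orb Λ) (Orb Λ × Orb Λ) ℂ) :
    rdmEnergy h g hnuc (U * γ * Uᴴ) (U ⊗ₖ U * Γ * (U ⊗ₖ U)ᴴ) = rdmEnergy h g hnuc γ Γ := by
  unfold rdmEnergy
  simp only [sum_conj_spinLift_one hUu hu', sum_sum_conj_spinLift_two hUu hu']

/-- **The exchange functional `Y(Γ) = Σ_{στ} Σ_{pq} Γ_{(pσ,qτ),(qσ,pτ)}` (the `⟨Ŝ²⟩` row of the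
spin-free singlet programme) is invariant under a unitary spin rotation.** -/
theorem exchangeSum_conj_spinLift
    (hUu : ∀ p q σ τ, U (orb p σ) (orb q τ) = if p = q then u σ τ else 0) (hu' : uᴴ * u = 1)
    (Γ : Matrix (Orb Λ × Orb Λ) (Orb Λ × Orb Λ) ℂ) :
    ∑ σ : Fin 2, ∑ τ : Fin 2, ∑ p : Λ, ∑ q : Λ,
        (U ⊗ₖ U * Γ * (U ⊗ₖ U)ᴴ) (orb p σ, orb q τ) (orb q σ, orb p τ) =
      ∑ σ : Fin 2, ∑ τ : Fin 2, ∑ p : Λ, ∑ q : Λ, Γ (orb p σ, orb q τ) (orb q σ, orb p τ) := by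
  have hswap : ∀ F : Fin 2 → Fin 2 → Λ → Λ → ℂ,
      ∑ σ, ∑ τ, ∑ p, ∑ q, F σ τ p q = ∑ p, ∑ q, ∑ σ, ∑ τ, F σ τ p q := fun F => by
    have hc := Finset.sum_comm (s := (Finset.univ : Finset (Fin 2 × Fin 2)))
      (t := (Finset.univ : Finset (Λ × Λ))) (f := fun z x => F z.1 z.2 x.1 x.2)
    simpa only [Fintype.sum_prod_type] using hc
  rw [hswap, hswap]
  exact Finset.sum_congr rfl fun p _ => Finset.sum_congr rfl fun q _ =>
    sum_sum_conj_spinLift_two hUu hu' Γ p q q p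

/-! ## §4 The spin lift of a unitary; convexity of the singlet-feasible set -/

/-- **The spin lift of a unitary spin matrix is unitary** (`u u† = 1 ⇒ U U† = 1`). -/
theorem spinLift_mul_conjTranspose
    (hUu : ∀ p q σ τ, U (orb p σ) (orb q τ) = if p = q then u σ τ else 0) (hu : u * uᴴ = 1) :
    U * Uᴴ = 1 := by
  ext i k
  obtain ⟨⟨p, σ⟩, rfl⟩ := toLex.surjective i
  obtain ⟨⟨q, τ⟩, rfl⟩ := toLex.surjective k
  change (U * Uᴴ) (orb p σ) (orb q τ) = (1 : Matrix (Orb Λ) (Orb Λ) ℂ) (orb p σ) (orb q τ)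
  have huq : (u * uᴴ) σ τ = ∑ b, u σ b * star (u τ b) := by
    simp only [mul_apply, conjTranspose_apply]
  calc (U * Uᴴ) (orb p σ) (orb q τ) = ∑ x, U (orb p σ) x * star (U (orb q τ) x) := by
        simp only [mul_apply, conjTranspose_apply]
    _ = ∑ b, U (orb p σ) (orb q b) * star (u τ b) := sum_spinLift_col hUu _ q τ
    _ = ∑ b, (if p = q then u σ b else 0) * star (u τ b) := by simp only [hUu]
    _ = if p = q then (u * uᴴ) σ τ else 0 := by
        split_ifs with hpq
        · rw [huq]
        · simp only [zero_mul, Finset.sum_const_zero]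
    _ = (1 : Matrix (Orb Λ) (Orb Λ) ℂ) (orb p σ) (orb q τ) := by
        rw [hu, one_apply, one_apply]
        simp only [EmbeddingLike.apply_eq_iff_eq, Prod.mk.injEq]
        by_cases hpq : p = q <;> by_cases hστ : σ = τ <;> simp [hpq, hστ]

/-- **The singlet-feasible set is convex**: a convex combination (real weights `w ≥ 0`, `Σ w = 1`) of
`DQG`-singlet-feasible pairs is `DQG`-singlet-feasible (the typer's sector convexity plus linearity
of row (98)). -/
theorem isDQGFeasibleSinglet_sum_smul {n : ℕ} {α : Type*} (s : Finset α) (w : α → ℝ)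
    (hw0 : ∀ x ∈ s, 0 ≤ w x) (hw1 : ∑ x ∈ s, w x = 1) {γ : α → Matrix (Orb Λ) (Orb Λ) ℂ}
    {Γ : α → Matrix (Orb Λ × Orb Λ) (Orb Λ × Orb Λ) ℂ}
    (h : ∀ x ∈ s, IsDQGFeasibleSinglet n (γ x) (Γ x)) :
    IsDQGFeasibleSinglet n (∑ x ∈ s, ((w x : ℝ) : ℂ) • γ x) (∑ x ∈ s, ((w x : ℝ) : ℂ) • Γ x) where
  toIsDQGFeasibleSector :=
    IsDQGFeasibleSector.sum_smul s w hw0 hw1 fun x hx => (h x hx).toIsDQGFeasibleSector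
  exchange_sum := by
    have hw1' : ∑ x ∈ s, ((w x : ℝ) : ℂ) = 1 := by
      rw [← Complex.ofReal_sum, hw1, Complex.ofReal_one]
    calc ∑ x : Λ, ∑ y : Λ, (∑ a ∈ s, ((w a : ℝ) : ℂ) • Γ a) (orb x 0, orb y 1) (orb y 0, orb x 1)
        = ∑ a ∈ s, ((w a : ℝ) : ℂ) * ∑ x : Λ, ∑ y : Λ, Γ a (orb x 0, orb y 1) (orb y 0, orb x 1) := by
          simp only [Matrix.sum_apply, Matrix.smul_apply, smul_eq_mul, Finset.mul_sum]
          symm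
          rw [Finset.sum_comm]
          exact Finset.sum_congr rfl fun x _ => Finset.sum_comm
      _ = n := by
          rw [Finset.sum_congr rfl fun a ha => by rw [(h a ha).exchange_sum], ← Finset.sum_mul, hw1',
            one_mul]

/-! ## §5 Spin-rotation covariance of the singlet programme; spin adaptation is lossless -/

/-- **THE SINGLET-FEASIBLE SET IS INVARIANT UNDER EVERY UNITARY SPIN ROTATION** `U = 1 ⊗ u`,
`uu† = 1`: `IsDQGFeasibleSinglet n γ Γ → IsDQGFeasibleSinglet n (UγU†) ((U⊗U)Γ(U⊗U)†)` — the
spin-orbital `N`-programme is invariant under every unitary (`isDQGFeasible_conj_unitary`) and the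
spin-free row `Y(Γ) = 2n(2−n)` is invariant (`exchangeSum_conj_spinLift`); the printed `S_z`-sector rows
and row (98) of the rotated pair then follow from `isDQGFeasibleSinglet_iff_spinFreeRow`. -/
theorem isDQGFeasibleSinglet_conj_spinLift
    (hUu : ∀ p q σ τ, U (orb p σ) (orb q τ) = if p = q then u σ τ else 0) (hu : u * uᴴ = 1)
    {n : ℕ} {γ : Matrix (Orb Λ) (Orb Λ) ℂ} {Γ : Matrix (Orb Λ × Orb Λ) (Orb Λ × Orb Λ) ℂ}
    (hf : IsDQGFeasibleSinglet n γ Γ) :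
    IsDQGFeasibleSinglet n (U * γ * Uᴴ) (U ⊗ₖ U * Γ * (U ⊗ₖ U)ᴴ) := by
  rw [isDQGFeasibleSinglet_iff_spinFreeRow] at hf ⊢
  exact ⟨isDQGFeasible_conj_unitary (spinLift_mul_conjTranspose hUu hu) hf.1,
    by rw [exchangeSum_conj_spinLift hUu (mul_eq_one_comm.mp hu), hf.2]⟩

/-- **The same at the `PQGT1T2′` rung** (the three-index cones are unitarily covariant — rdm-B's
`isDQGT1T2PrimeFeasible_conj_unitary`). -/
theorem isDQGT1T2PrimeFeasibleSinglet_conj_spinLift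
    (hUu : ∀ p q σ τ, U (orb p σ) (orb q τ) = if p = q then u σ τ else 0) (hu : u * uᴴ = 1)
    {n : ℕ} {γ : Matrix (Orb Λ) (Orb Λ) ℂ} {Γ : Matrix (Orb Λ × Orb Λ) (Orb Λ × Orb Λ) ℂ}
    (hf : IsDQGT1T2PrimeFeasibleSinglet n γ Γ) :
    IsDQGT1T2PrimeFeasibleSinglet n (U * γ * Uᴴ) (U ⊗ₖ U * Γ * (U ⊗ₖ U)ᴴ) := by
  rw [isDQGT1T2PrimeFeasibleSinglet_iff_spinFreeRow] at hf ⊢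
  exact ⟨isDQGT1T2PrimeFeasible_conj_unitary (spinLift_mul_conjTranspose hUu hu) hf.1,
    by rw [exchangeSum_conj_spinLift hUu (mul_eq_one_comm.mp hu), hf.2]⟩

variable {G : Type*} [Group G] [Fintype G]

/-- The uniform weights `1/|G|` sum to one. -/
private theorem sum_card_inv_eq_one : ∑ _g : G, ((Fintype.card G : ℝ)⁻¹ : ℝ) = 1 := by
  rw [Finset.sum_const, Finset.card_univ, nsmul_eq_mul,
    mul_inv_cancel₀ (Nat.cast_ne_zero.mpr (Fintype.card_pos_iff.mpr ⟨1⟩).ne')]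

/-- **The average over a finite group of spin rotations of a singlet-feasible pair is
singlet-feasible** (`ρ(g) = 1 ⊗ υ(g)` unitary spin lifts; invariance for each `g` + convexity). -/
theorem isDQGFeasibleSinglet_spinRotationAverage (ρ : G →* Matrix (Orb Λ) (Orb Λ) ℂ)
    (υ : G → Matrix (Fin 2) (Fin 2) ℂ)
    (hρ : ∀ g p q σ τ, ρ g (orb p σ) (orb q τ) = if p = q then υ g σ τ else 0)
    (hυ : ∀ g, υ g * (υ g)ᴴ = 1) {n : ℕ} {γ : Matrix (Orb Λ) (Orb Λ) ℂ}
    {Γ : Matrix (Orb Λ × Orb Λ) (Orb Λ × Orb Λ) ℂ} (hf : IsDQGFeasibleSinglet n γ Γ) :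
    IsDQGFeasibleSinglet n (∑ g : G, (((Fintype.card G : ℝ)⁻¹ : ℝ) : ℂ) • (ρ g * γ * (ρ g)ᴴ))
      (∑ g : G, (((Fintype.card G : ℝ)⁻¹ : ℝ) : ℂ) • (ρ g ⊗ₖ ρ g * Γ * (ρ g ⊗ₖ ρ g)ᴴ)) :=
  isDQGFeasibleSinglet_sum_smul Finset.univ (fun _ => (Fintype.card G : ℝ)⁻¹)
    (fun _ _ => inv_nonneg.mpr (Nat.cast_nonneg _)) sum_card_inv_eq_one
    fun g _ => isDQGFeasibleSinglet_conj_spinLift (hρ g) (hυ g) hf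

/-- **SPIN ADAPTATION OF THE SINGLET PROGRAMME IS LOSSLESS** (Gatermann–Parrilo Thm 3.3 for a finite
group `G` acting by unitary spin rotations `ρ(g) = 1 ⊗ υ(g)`): `c ≤ E_PQG(2n, S = 0)` iff `c` lies below
`Re E_{h,g}` on the `ρ`-INVARIANT singlet-feasible pairs only (`n ≤ |Λ|`; no hypothesis on the integral
tables — the functional is spin-free). The averaged pair is feasible, invariant
(`rotationAverage_one_conj` / `two_conj`) and has the same energy (`rdmEnergy_rotationAverage` with
`rdmEnergy_conj_spinLift`). -/
theorem le_pqgSingletEnergy_iff_spinRotationInvariant (h : Λ → Λ → ℂ) (g₂ : Λ → Λ → Λ → Λ → ℂ)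
    (hnuc : ℂ) {n : ℕ} (hn : n ≤ Fintype.card Λ) (ρ : G →* Matrix (Orb Λ) (Orb Λ) ℂ)
    (υ : G → Matrix (Fin 2) (Fin 2) ℂ)
    (hρ : ∀ g p q σ τ, ρ g (orb p σ) (orb q τ) = if p = q then υ g σ τ else 0)
    (hυ : ∀ g, υ g * (υ g)ᴴ = 1) (c : ℝ) :
    c ≤ pqgSingletEnergy h g₂ hnuc n ↔
      ∀ γ Γ, IsDQGFeasibleSinglet n γ Γ →
        (∀ g : G, ρ g * γ * (ρ g)ᴴ = γ ∧ ρ g ⊗ₖ ρ g * Γ * (ρ g ⊗ₖ ρ g)ᴴ = Γ) →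
        c ≤ (rdmEnergy h g₂ hnuc γ Γ).re := by
  have hE : ∀ (g : G) (γ : Matrix (Orb Λ) (Orb Λ) ℂ) (Γ : Matrix (Orb Λ × Orb Λ) (Orb Λ × Orb Λ) ℂ),
      rdmEnergy h g₂ hnuc (ρ g * γ * (ρ g)ᴴ) (ρ g ⊗ₖ ρ g * Γ * (ρ g ⊗ₖ ρ g)ᴴ) =
        rdmEnergy h g₂ hnuc γ Γ :=
    fun g γ Γ => rdmEnergy_conj_spinLift (hρ g) (mul_eq_one_comm.mp (hυ g)) h g₂ hnuc γ Γ
  rw [le_pqgSingletEnergy_iff h g₂ hnuc hn]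
  refine ⟨fun hc γ Γ hf _ => hc γ Γ hf, fun hc γ Γ hf => ?_⟩
  rw [← rdmEnergy_rotationAverage h g₂ hnuc ρ hE γ Γ]
  exact hc _ _ (isDQGFeasibleSinglet_spinRotationAverage ρ υ hρ hυ hf) fun g =>
    ⟨rotationAverage_one_conj ρ _ γ g, rotationAverage_two_conj ρ _ Γ g⟩

end Summit.Ventures.CertifiedQuantumChemistry

end
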